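import Literature.Probability.RandomPlanarGeometry.HexSAWSurfaceWallRenewalTwoDownFamilies
import HarnessLib

/-!
# The two-down law: `#{ω ∈ ipwb (6k + 2j) : visits = k, #down = 2} = 2j + k − 1` at every slack

For the self-avoiding walk on the honeycomb lattice (brick-wall frame) in the half-plane `Y ≤ 0`, an IRREDUCIBLE
POSITIVE WALL BRIDGE `ω ∈ ipwb n` with `v = visits n ω` surface visits satisfies the six-step law `6v ≤ n`
(`HexSAWSurfaceWallRenewalSixStep`); a block of length `6k + 2j` with `k` visits has SLACK `2j`, and its number of
down steps `d = #stepsD` obeys `2d + 6v ≤ n + 4` (`HexSAWSurfaceWallRenewalIteratedGap`), so `d ≤ j + 2`.  This module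
CLASSIFIES the lowest vertical stratum `d = 2` at EVERY slack at once (length symbolic, `hm : m = 6 * k + 2 * j`,
`k ≥ 2`, `j ≥ 1`): a block with `k` visits and exactly two down steps is one of the `2j + k − 1` explicit blocks of
`HexSAWSurfaceWallRenewalTwoDownFamilies` (the O blocks `s2o k j i`, `i ≤ j − 2`; the T blocks `s2t k j a`,
`1 ≤ a ≤ k − 1`; the H blocks `s2h k j i`, `i ≤ j`), hence

* ★★★ `filter_visits_two_down_eq_twoDownBlocksS`: `{ω ∈ ipwb (6k+2j) : visits = k, #down = 2} = twoDownBlocksS k j`;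
* ★★★ `card_filter_visits_two_down_slack`: `#{ω ∈ ipwb (6k+2j) : visits = k, #down = 2} = 2j + k − 1` — the
  TWO-DOWN LAW, linear in the slack and in the visits: `k + 1` at slack two (the two-down part of
  `HexSAWSurfaceWallRenewalSlackTwoClassification`), `k + 3` at slack four (`HexSAWSurfaceWallRenewalSlackFourTwoDown`),
  `k + 5, k + 7, …`.

PROOF (§5, the slack-four argument of `HexSAWSurfaceWallRenewalSlackFourTwoDown` §5 with the slack as a parameter; every
tool is general-length and comes from `HexSAWSurfaceWallRenewalSlackTwoClassification`).  By
`profile_of_card_stepsD_eq_two` the vertical profile is `D D U U` or `D U D U`, the latter impossible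
(`dudu_false_of_mem_ipwb`).  For `D D U U` write the block as `R^p D h₁ D h₂ U h₃ U R^f` with runs of directions
`e1 e2 e3` ending at columns `b, c, d` (`dduuS_runs`: the runs by `run_const_velocity`, `s = p + 4k + 2j − 1` from the
visit count, `p + 2 ≤ d ≤ p + 2j + 2` from the gap and charge counts of `HexSAWSurfaceWallRenewalSixStepRigid`).  The
signs (`dduuS_signs`): the two row-`−1` runs are disjoint (`dduu_row_disjoint`); irreducibility shields the initial wall
run — `p ≥ 3` forces a later return to column `≤ 2` (`dduu_shield_low`) — and the final wall run — `f ≥ 3` forces an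
earlier visit to column `≥ X − 1` below the wall (`dduu_shield_high`); with the run lengths this leaves exactly three
sign patterns and pins the columns: `R R L` with `p = 1`, `c = X = 2k + 2j − 2`, `d = 2j − 1`, `b` even in
`[2, 2j − 2]` (O); `L R L` with `b = 2`, `c = 2k + 2j`, `d = p + 2j` (T); `L R R` with `b = 2`, `p = 2k − 1`,
`d = 2k + 2j + 1`, `c` even in `[2k, 2k + 2j]` (H) — here `k ≥ 2` excludes `R R R` (the final wall run has
`2k − 1 ≥ 3` steps).  The tables (`dduuS_tables`) then agree with `s2oX/Y`, `s2tX/Y`, `s2hX/Y` piece by piece, and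
`eq_tab_walk_of_forall` identifies the block (§6).

STATUS: lane theorem of the a-idea-1 bridge/renewal lineage (cars 71 `…SixStep`, 73 `…SixStepRigid`, 74a/b
`…SlackTwoFamilies` / `…SlackTwoClassification`, 77 `…SlackFourTwoDown`, 83 `…TwoDownFamilies`).  OURS (new in writing,
modest; registered in the lane's pre-registration file as amendment BK «TWO-DOWN LAW» with blind cells before any
certification): the printed sources carry the renewal / irreducible-bridge structure (Madras–Slade §1.2, Definition
1.2.4 (p. 11); §4.2, Definition 4.2.1 (p. 90); Kesten), the brickwork frame of the honeycomb lattice (Enting–Jensen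
§7.4.2, Fig. 7.10) and the surface-visit statistic (Beaton et al. §3.1) — none states this classification or count.
Checked against the author's enumeration of all irreducible positive wall bridges of length `n ≤ 24` from the
definitions (`#ipwb(n)` = 1, 0, 1, 1, 3, 7, 18, 49, 133, 373, 1 066, 3 078): for every `(k, j)` with `k ≥ 2`, `j ≥ 1`,
`6k + 2j ≤ 24` the two-down stratum has exactly `2j + k − 1` members (`(k, j) = (2,1..6)`: 3, 5, 7, 9, 11, 13;
`(3,1..3)`: 4, 6, 8; the rows `k = 1` — `(j+2)(j−1)/2` — and `j = 0` — one block — are outside the hypotheses).  No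
`set_option` line is used: every declaration elaborates within the default heart-beat budget on the reference farm.
-/

namespace Literature.Probability.RandomPlanarGeometry.SAW.HexBW.Wall

open Finset Filter Function
open Literature.Probability.LatticeModels Literature.Probability.Percolation SimpleGraph

variable {ω : ℕ → Site 2}

/-- Extensionality for sites of `ℤ²` from the two coordinates (plumbing). [folklore] -/
private theorem site_ext_tds {p q : Site 2} (h0 : p 0 = q 0) (h1 : p 1 = q 1) : p = q := by
  ext i; fin_cases i; exacts [h0, h1]

/-! ### §5  Classification of the profile `D D U U` at slack `2j`: the runs, the signs, the tables -/

/-- DDUU at slack `2j`, step 1 — **the runs** (cf. `dduu_runs` at slack two, `dduu4_runs` at slack four): run 1 on row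
`−1` (direction `e1`) to the second down step at the even column `b = ω q 0`, run 2 on row `−2` (direction `e2`) to
the first up step at the even column `c = ω r 0`, run 3 on row `−1` (direction `e3`) to the last up step at the odd
column `d = ω s 0`, run 4 rightward on the wall; the visit count `v = ⌊p/2⌋ + (m−s)/2 = k` gives
`s = p + 4k + 2j − 1`, and the gap and charge counts `2k + 2 ≤ X ≤ 2k + 2j + 2` of
`HexSAWSurfaceWallRenewalSixStepRigid` give `p + 2 ≤ d ≤ p + 2j + 2`.
[cite: MadrasSlade1993, §4.2, Definition 4.2.1 (p. 90); EntingJensen2009, §7.4.2, Fig. 7.10] -/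
theorem dduuS_runs {k j m : ℕ} (hk : 2 ≤ k) (hj : 1 ≤ j) (hm : m = 6 * k + 2 * j) (hω : ω ∈ ipwb m)
    (hv : visits m ω = k)
    {p q r s : ℕ} (hDpq : stepsD m ω = {p, q}) (hUrs : stepsU m ω = {r, s}) (hpq : p < q) (hrs : r < s)
    (hqr : q < r) (hp1 : 1 ≤ p) (hR0 : ∀ i, i ≤ p → ω i 0 = i ∧ ω i 1 = 0)
    (hP1x : ω (p + 1) 0 = p) (hP1y : ω (p + 1) 1 = -1)
    (hhor : ∀ i, i < m → i ≠ p → i ≠ q → i ≠ r → i ≠ s →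
      ω (i + 1) 1 = ω i 1 ∧ (ω (i + 1) 0 = ω i 0 + 1 ∨ ω (i + 1) 0 = ω i 0 - 1)) :
    ∃ e1 e2 e3 : ℤ, (e1 = 1 ∨ e1 = -1) ∧ (e2 = 1 ∨ e2 = -1) ∧ (e3 = 1 ∨ e3 = -1) ∧
      (∀ i, p + 1 ≤ i → i ≤ q → ω i 0 = p + e1 * ((i - (p + 1) : ℕ) : ℤ) ∧ ω i 1 = -1) ∧
      (∀ i, q + 1 ≤ i → i ≤ r → ω i 0 = ω q 0 + e2 * ((i - (q + 1) : ℕ) : ℤ) ∧ ω i 1 = -2) ∧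
      (∀ i, r + 1 ≤ i → i ≤ s → ω i 0 = ω r 0 + e3 * ((i - (r + 1) : ℕ) : ℤ) ∧ ω i 1 = -1) ∧
      (∀ j, s + 1 ≤ j → j ≤ m → ω j 0 = ω s 0 + ((j - (s + 1) : ℕ) : ℤ) ∧ ω j 1 = 0) ∧
      s = p + 4 * k + 2 * j - 1 ∧ ((p : ℤ) + 2 ≤ ω s 0 ∧ ω s 0 ≤ p + 2 * j + 2 ∧ ω s 0 % 2 = 1) ∧ ω q 0 % 2 = 0 ∧
      ω r 0 % 2 = 0 ∧ 0 < ω q 0 ∧ 0 < ω r 0 ∧ p + 2 ≤ q ∧ q + 2 ≤ r ∧ s < m ∧ ω r 0 ≤ ω m 0 := by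
  classical
  obtain ⟨hpw, hn1, hirr⟩ := mem_ipwb.1 hω
  obtain ⟨hw, hb⟩ := mem_pwb.1 hpw
  obtain ⟨ha, -⟩ := mem_wbr.1 hw
  obtain ⟨hh, -, -⟩ := mem_archs.1 ha
  obtain ⟨hs, hhp⟩ := mem_hpw.1 hh
  obtain ⟨h0, -, hbw, hinj⟩ := mem_saws_iff.1 hs
  have hX0 : ω 0 0 = 0 := by rw [h0]; rfl
  have hb' : ∀ i, 1 ≤ i → i ≤ m → 0 < ω i 0 ∧ ω i 0 ≤ ω m 0 := fun i h1 h2 => by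
    have := hb i h1 h2; rwa [hX0] at this
  have hmem : ∀ i, i ≤ m → i ∈ {i | i ≤ m} := fun i hi => hi
  obtain ⟨hpn, hpx, hpy, hppar⟩ := of_mem_stepsD_coord hbw (i := p) (by rw [hDpq]; simp)
  obtain ⟨hqn, hqx, hqy, hqpar⟩ := of_mem_stepsD_coord hbw (i := q) (by rw [hDpq]; simp)
  obtain ⟨hrn, hrx, hry, hrpar⟩ := of_mem_stepsU_coord hbw (i := r) (by rw [hUrs]; simp)
  obtain ⟨hsn, hsx, hsy, hspar⟩ := of_mem_stepsU_coord hbw (i := s) (by rw [hUrs]; simp)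
  -- run 1 on row `−1`
  obtain ⟨e1, he1, hrun1⟩ := run_const_velocity hinj (a := p + 1) (b := q) (by omega) (by omega)
    (fun i h1 h2 => hhor i (by omega) (by omega) (by omega) (by omega) (by omega))
  have hQy : ω q 1 = -1 := by rw [(hrun1 q (by omega) le_rfl).2, hP1y]
  have hQ1y : ω (q + 1) 1 = -2 := by rw [hqy, hQy]; rfl
  have hbev : ω q 0 % 2 = 0 := by rw [hqx, hQ1y] at hqpar; omega
  have hb1 := (hb' q (by omega) (by omega)).1
  -- run 2 on row `−2`
  obtain ⟨e2, he2, hrun2⟩ := run_const_velocity hinj (a := q + 1) (b := r) (by omega) (by omega)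
    (fun i h1 h2 => hhor i (by omega) (by omega) (by omega) (by omega) (by omega))
  have hRy : ω r 1 = -2 := by rw [(hrun2 r (by omega) le_rfl).2, hQ1y]
  have hR1y : ω (r + 1) 1 = -1 := by rw [hry, hRy]; rfl
  have hcev : ω r 0 % 2 = 0 := by rw [hRy] at hrpar; omega
  have hc1 := (hb' r (by omega) (by omega)).1
  have hcX := (hb' r (by omega) (by omega)).2
  -- run 3 on row `−1`
  obtain ⟨e3, he3, hrun3⟩ := run_const_velocity hinj (a := r + 1) (b := s) (by omega) (by omega)
    (fun i h1 h2 => hhor i (by omega) (by omega) (by omega) (by omega) (by omega))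
  have hSy : ω s 1 = -1 := by rw [(hrun3 s (by omega) le_rfl).2, hR1y]
  have hS1y : ω (s + 1) 1 = 0 := by rw [hsy, hSy]; rfl
  have hsev : s % 2 = 0 := by have := parity_apply hs (show s ≤ m by omega); rw [hSy] at this; omega
  have hdodd : ω s 0 % 2 = 1 := by rw [hSy] at hspar; omega
  -- run 4 on the wall goes right
  obtain ⟨e4, he4, hrun4⟩ := run_const_velocity hinj (a := s + 1) (b := m) (by omega) le_rfl
    (fun i h1 h2 => hhor i (by omega) (by omega) (by omega) (by omega) (by omega))
  obtain rfl : e4 = 1 := by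
    rcases he4 with h | rfl
    · exact h
    exfalso
    have hN := (hrun4 m (by omega) le_rfl).1
    have hbn := (hb' (s + 1) (by omega) (by omega)).2
    rw [hsx] at hN hbn
    omega
  have hR4 : ∀ j, s + 1 ≤ j → j ≤ m → ω j 0 = ω s 0 + ((j - (s + 1) : ℕ) : ℤ) ∧ ω j 1 = 0 := fun j h1 h2 => by
    obtain ⟨hx, hy⟩ := hrun4 j h1 h2
    rw [hsx] at hx; rw [hS1y] at hy
    exact ⟨by rw [hx]; ring, hy⟩
  -- the visit count `v = ⌊p/2⌋ + (m − s)/2`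
  have hvf : visits m ω = p / 2 + (m - s) / 2 := by
    have hv1 : visits p ω = p / 2 := visits_eq_div_two_of_wall (fun i _ h2 => (hR0 i h2).2)
    have hv2 : visits s ω = visits p ω := by
      have := visits_add_eq_left (k := p) (b := s - p) (ζ := ω) (fun j hj1 hj2 => ?_)
      · rwa [show p + (s - p) = s by omega] at this
      rintro ⟨-, hy⟩
      rcases Nat.lt_or_ge (p + j) (q + 1) with hj | hj
      · have := (hrun1 (p + j) (by omega) (by omega)).2; rw [hP1y] at this; omega
      rcases Nat.lt_or_ge (p + j) (r + 1) with hj' | hj'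
      · have := (hrun2 (p + j) hj (by omega)).2; rw [hQ1y] at this; omega
      · have := (hrun3 (p + j) hj' (by omega)).2; rw [hR1y] at this; omega
    have hv3 : visits m ω = visits s ω + visits (m - s) (fun _ => (0 : Site 2)) := by
      have := visits_add (a := s) (b := m - s) (ζ := ω) (ξ := fun _ => (0 : Site 2)) hsev (fun j hj1 hj2 => ?_)
      · rwa [show s + (m - s) = m by omega] at this
      rw [(hR4 (s + j) (by omega) (by omega)).2]; rfl
    have hv4 : visits (m - s) (fun _ => (0 : Site 2)) = (m - s) / 2 := visits_eq_div_two_of_wall (fun i _ _ => rfl)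
    rw [hv3, hv2, hv1, hv4]
  -- slack numerics: `2k + 2 ≤ X ≤ 2k + 2j + 2` (gap count and charge count)
  have hX1 := two_mul_visits_add_two_le_apply hω (by omega)
  have hX2 := apply_add_four_mul_visits_le hω (by omega)
  rw [hv] at hX1 hX2
  have hN := (hR4 m (by omega) le_rfl).1
  rw [hvf] at hv
  have hpodd : p % 2 = 1 := by rw [hP1x, hP1y] at hppar; omega
  have hs_eq : s = p + 4 * k + 2 * j - 1 := by omega
  have hd3 : (p : ℤ) + 2 ≤ ω s 0 ∧ ω s 0 ≤ p + 2 * j + 2 ∧ ω s 0 % 2 = 1 := by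
    refine ⟨?_, ?_, hdodd⟩ <;> · subst hs_eq; rw [hm] at hN hX1 hX2; push_cast at hN hX1 hX2; omega
  have hq2 : p + 2 ≤ q := by
    by_contra h
    obtain rfl : q = p + 1 := by omega
    rw [hqx, hP1x] at hqpar; rw [hQ1y] at hqpar; omega
  have hr2 : q + 2 ≤ r := by
    by_contra h
    obtain rfl : r = q + 1 := by omega
    have := hinj (hmem (q + 1 + 1) (by omega)) (hmem q (by omega)) (site_ext_tds (by rw [hrx, hqx]) (by rw [hR1y, hQy]))
    omega
  refine ⟨e1, e2, e3, he1, he2, he3, fun i h1 h2 => ⟨by rw [(hrun1 i h1 h2).1, hP1x], by rw [(hrun1 i h1 h2).2, hP1y]⟩,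
    fun i h1 h2 => ⟨by rw [(hrun2 i h1 h2).1, hqx], by rw [(hrun2 i h1 h2).2, hQ1y]⟩,
    fun i h1 h2 => ⟨by rw [(hrun3 i h1 h2).1, hrx], by rw [(hrun3 i h1 h2).2, hR1y]⟩, hR4, hs_eq, hd3, hbev, hcev, hb1,
    hc1, hq2, hr2, hsn, hcX⟩

/-- DDUU at slack `2j`, step 2 — **the signs and columns**: either the dive is at column `1` and run 1 goes RIGHT to an even
column `b ≤ 2j − 2` (then run 2 reaches `X = 2k + 2j − 2` and run 3 returns leftward to column `2j − 1`: the O blocks), or run 1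
is the hairpin return to column `2`, run 2 goes right beyond column `p`, and then either run 3 returns LEFTWARD (the lengths
force `c = 2k + 2j`, `d = p + 2j`: the T blocks) or run 3 continues RIGHTWARD (the lengths force `p = 2k − 1`, `d = 2k + 2j + 1`,
and `c` is an even column in `[2k, 2k + 2j]`: the H blocks).  Excluded: a rightward run 1 from `p ≥ 3` by (I1) (run 3 would
climb through column `p`); from `p = 1` a leftward run 2 puts the start of run 3 on run 1, and two rightward runs below
contradict (I2) (here `k ≥ 2` is used: the final wall run has `2k − 1 ≥ 3` steps).
[cite: MadrasSlade1993, §4.2, Definition 4.2.1 (p. 90); EntingJensen2009, §7.4.2, Fig. 7.10] -/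
theorem dduuS_signs {k j m p q r s : ℕ} {e1 e2 e3 : ℤ} (hk : 2 ≤ k) (hj : 1 ≤ j) (hm : m = 6 * k + 2 * j)
    (he1 : e1 = 1 ∨ e1 = -1) (he2 : e2 = 1 ∨ e2 = -1) (he3 : e3 = 1 ∨ e3 = -1) (hp1 : 1 ≤ p) (hpodd : p % 2 = 1) (hrs : r < s)
    (hs_eq : s = p + 4 * k + 2 * j - 1) (hd3 : (p : ℤ) + 2 ≤ ω s 0 ∧ ω s 0 ≤ p + 2 * j + 2 ∧ ω s 0 % 2 = 1)
    (hbev : ω q 0 % 2 = 0)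
    (hcev : ω r 0 % 2 = 0) (hb1 : 0 < ω q 0) (hc1 : 0 < ω r 0) (hq2 : p + 2 ≤ q) (hr2 : q + 2 ≤ r) (hsm : s < m)
    (hcX : ω r 0 ≤ ω m 0)
    (hbq : ω q 0 = p + e1 * ((q - (p + 1) : ℕ) : ℤ)) (hcr : ω r 0 = ω q 0 + e2 * ((r - (q + 1) : ℕ) : ℤ))
    (hds : ω s 0 = ω r 0 + e3 * ((s - (r + 1) : ℕ) : ℤ)) (hN : ω m 0 = ω s 0 + ((m - (s + 1) : ℕ) : ℤ))
    (hP1x : ω (p + 1) 0 = p) (hrx : ω (r + 1) 0 = ω r 0)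
    (hrun1 : ∀ i, p + 1 ≤ i → i ≤ q → ω i 0 = p + e1 * ((i - (p + 1) : ℕ) : ℤ))
    (hrun3 : ∀ i, r + 1 ≤ i → i ≤ s → ω i 0 = ω r 0 + e3 * ((i - (r + 1) : ℕ) : ℤ))
    (hdisj : ∀ i j, p + 1 ≤ i → i ≤ q → r + 1 ≤ j → j ≤ s → ω i 0 ≠ ω j 0)
    (hI1 : 3 ≤ p → ω q 0 ≤ 2 ∨ ω r 0 ≤ 2) (hI2 : s + 4 ≤ m → ω m 0 ≤ ω q 0 + 1 ∨ ω m 0 ≤ ω r 0 + 1) :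
    (p = 1 ∧ e1 = 1 ∧ (2 ≤ ω q 0 ∧ ω q 0 + 2 ≤ 2 * j) ∧ e2 = 1 ∧ ω r 0 = 2 * k + 2 * j - 2 ∧ e3 = -1 ∧ ω s 0 = 2 * j - 1) ∨
      (e1 = -1 ∧ ω q 0 = 2 ∧ e2 = 1 ∧ e3 = -1 ∧ ω r 0 = 2 * k + 2 * j ∧ ω s 0 = p + 2 * j ∧ p + 2 ≤ 2 * k + 1) ∨
      (e1 = -1 ∧ ω q 0 = 2 ∧ e2 = 1 ∧ e3 = 1 ∧ p = 2 * k - 1 ∧ ω s 0 = 2 * k + 2 * j + 1 ∧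
        (2 * (k : ℤ) ≤ ω r 0 ∧ ω r 0 ≤ 2 * k + 2 * j)) := by
  obtain ⟨hdlo, hdhi, hdodd⟩ := hd3
  -- normalise the run lengths first (no truncated subtraction is left to the arithmetic below)
  obtain ⟨hs1, hl1, hl2, hl3, hl4⟩ : s + 1 = p + 4 * k + 2 * j ∧ ((q - (p + 1) : ℕ) : ℤ) = q - p - 1 ∧
      ((r - (q + 1) : ℕ) : ℤ) = r - q - 1 ∧ ((s - (r + 1) : ℕ) : ℤ) = s - r - 1 ∧ ((m - (s + 1) : ℕ) : ℤ) = m - s - 1 :=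
    ⟨by omega, by omega, by omega, by omega, by omega⟩
  rw [hl1] at hbq; rw [hl2] at hcr; rw [hl3] at hds; rw [hl4] at hN
  clear hs_eq hl1 hl2 hl3 hl4
  rcases he1 with rfl | rfl
  · -- run 1 rightward: only the dive at column `1` survives
    left
    rcases Nat.lt_or_ge p 3 with hp3 | hp3
    · obtain rfl : p = 1 := by omega
      have hbd : ω q 0 < ω s 0 := by
        -- else the last up column `d ≤ b` lies on run 1
        by_contra hge
        refine hdisj ((ω s 0).toNat + 1) s (by omega) (by omega) (by omega) le_rfl ?_
        rw [hrun1 ((ω s 0).toNat + 1) (by omega) (by omega)]; omega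
      rcases he2 with rfl | rfl
      · rcases he3 with rfl | rfl
        · -- three rightward runs: `X = d + 2k − 1` exceeds `b + 1` and `c + 1`, against (I2)
          exfalso
          rcases hI2 (by omega) with h | h <;> omega
        · -- run 3 leftward: `c ≥ X − 1` by (I2), the lengths give `d = 2j − 1`, `c = X = 2k + 2j − 2`, and `b < d`
          rcases hI2 (by omega) with h | h
          · exfalso; omega
          · refine ⟨rfl, rfl, ⟨?_, ?_⟩, rfl, ?_, rfl, ?_⟩ <;> omega
      · -- run 2 leftward from `b`: the first up column `c ∈ [1, b − 1]` lies on run 1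
        exfalso
        refine hdisj ((ω r 0).toNat + 1) (r + 1) (by omega) (by omega) le_rfl (by omega) ?_
        rw [hrun1 ((ω r 0).toNat + 1) (by omega) (by omega), hrx]; omega
    · -- `p ≥ 3`: (I1) gives `c ≤ 2` (`b > p`), and run 3 must then climb rightward through column `p = ω (p+1) 0`
      exfalso
      rcases hI1 hp3 with hb2 | hc2
      · omega
      · rcases he3 with rfl | rfl
        · refine hdisj (p + 1) (r + 1 + (p - (ω r 0).toNat)) le_rfl (by omega) (by omega) (by omega) ?_
          rw [hP1x, hrun3 (r + 1 + (p - (ω r 0).toNat)) (by omega) (by omega)]; omega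
        · omega
  · -- run 1 leftward: the hairpin return to column `2`, then run 2 rightward beyond column `p`
    right
    have hp3 : 3 ≤ p := by omega
    have hb2 : ω q 0 = 2 := by
      rcases hI1 hp3 with hb2 | hc2
      · omega
      · exfalso
        rcases he3 with rfl | rfl
        · refine hdisj q (r + 1 + ((ω q 0).toNat - 2)) (by omega) le_rfl (by omega) (by omega) ?_
          rw [hrun3 (r + 1 + ((ω q 0).toNat - 2)) (by omega) (by omega)]; omega
        · omega
    have hE2 : e2 = 1 := by
      rcases he2 with h | rfl
      · exact h
      exfalso; omega
    subst hE2
    have hcp : (p : ℤ) < ω r 0 := by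
      by_contra hle
      refine hdisj (p + 1 + (p - (ω r 0).toNat)) (r + 1) (by omega) (by omega) le_rfl (by omega) ?_
      rw [hrun1 (p + 1 + (p - (ω r 0).toNat)) (by omega) (by omega), hrx]; omega
    rcases he3 with rfl | rfl
    · -- run 3 rightward: `d = 4k + 2j − p ≤ p + 2j + 2` with `p ≤ 2k − 1` forces `p = 2k − 1`
      right
      refine ⟨rfl, hb2, rfl, rfl, ?_, ?_, ⟨?_, ?_⟩⟩ <;> omega
    · -- run 3 leftward: `2c = 4k + 2j + (d − p)` with `c` even, `c ≤ X`, `d ≤ p + 2j + 2` forces `c = 2k + 2j`, `d = p + 2j`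
      left
      refine ⟨rfl, hb2, rfl, rfl, ?_, ?_, ?_⟩ <;> omega

/-- DDUU at slack `2j`, step 3a — **the O tables**: with the O signs and columns (`p = 1`, `b = 2i + 2 ≤ 2j − 2`,
`c = 2k + 2j − 2`, `d = 2j − 1`) the walk agrees with the O table of parameter `i` at every time `≤ m`.
[cite: MadrasSlade1993, §4.2, Definition 4.2.1 (p. 90); EntingJensen2009, §7.4.2, Fig. 7.10] -/
theorem dduuS_table_o {k j m p q r s : ℕ} {e1 e2 e3 : ℤ} (hm : m = 6 * k + 2 * j)
    (hR0 : ∀ i, i ≤ p → ω i 0 = i ∧ ω i 1 = 0)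
    (hrun1 : ∀ i, p + 1 ≤ i → i ≤ q → ω i 0 = p + e1 * ((i - (p + 1) : ℕ) : ℤ) ∧ ω i 1 = -1)
    (hrun2 : ∀ i, q + 1 ≤ i → i ≤ r → ω i 0 = ω q 0 + e2 * ((i - (q + 1) : ℕ) : ℤ) ∧ ω i 1 = -2)
    (hrun3 : ∀ i, r + 1 ≤ i → i ≤ s → ω i 0 = ω r 0 + e3 * ((i - (r + 1) : ℕ) : ℤ) ∧ ω i 1 = -1)
    (hR4 : ∀ j, s + 1 ≤ j → j ≤ m → ω j 0 = ω s 0 + ((j - (s + 1) : ℕ) : ℤ) ∧ ω j 1 = 0)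
    (hpq : p < q) (hqr : q < r) (hrs : r < s) (hpodd : p % 2 = 1) (hs_eq : s = p + 4 * k + 2 * j - 1)
    (hbq : ω q 0 = p + e1 * ((q - (p + 1) : ℕ) : ℤ)) (hcr : ω r 0 = ω q 0 + e2 * ((r - (q + 1) : ℕ) : ℤ))
    (hds : ω s 0 = ω r 0 + e3 * ((s - (r + 1) : ℕ) : ℤ))
    (hp : p = 1) (he1 : e1 = 1) (hb : 2 ≤ ω q 0 ∧ ω q 0 + 2 ≤ 2 * j) (hbev : ω q 0 % 2 = 0) (he2 : e2 = 1)
    (hc : ω r 0 = 2 * k + 2 * j - 2) (he3 : e3 = -1) (hd : ω s 0 = 2 * j - 1) :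
    ∃ i, i + 2 ≤ j ∧ ∀ t, t ≤ m → ω t 0 = s2oX k j i t ∧ ω t 1 = s2oY k j i t := by
  subst hp he1 he2 he3
  obtain ⟨l, hlj, hbl⟩ : ∃ l : ℕ, l + 2 ≤ j ∧ ω q 0 = 2 * l + 2 :=
    ⟨((ω q 0).toNat - 2) / 2, by omega, by omega⟩
  have hq_eq : q = 2 * l + 3 := by omega
  have hr_eq : r = 2 * k + 2 * j := by omega
  clear hcr hds hbq hb
  refine ⟨l, hlj, fun i hi => ?_⟩
  simp only [s2oX, s2oY]
  rcases Nat.lt_or_ge i (1 + 1) with h1 | h1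
  · obtain ⟨hx, hy⟩ := hR0 i (by omega)
    rw [hx, hy]; constructor <;> split_ifs <;> omega
  rcases Nat.lt_or_ge i (q + 1) with h2 | h2
  · obtain ⟨hx, hy⟩ := hrun1 i h1 (by omega)
    rw [hx, hy]; constructor <;> split_ifs <;> omega
  rcases Nat.lt_or_ge i (r + 1) with h3 | h3
  · obtain ⟨hx, hy⟩ := hrun2 i h2 (by omega)
    rw [hx, hy]; constructor <;> split_ifs <;> omega
  rcases Nat.lt_or_ge i (s + 1) with h4 | h4
  · obtain ⟨hx, hy⟩ := hrun3 i h3 (by omega)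
    rw [hx, hy]; constructor <;> split_ifs <;> omega
  · obtain ⟨hx, hy⟩ := hR4 i h4 hi
    rw [hx, hy]; constructor <;> split_ifs <;> omega

/-- DDUU at slack `2j`, step 3b — **the T tables**: with the T signs and columns (hairpin to `b = 2`, `c = 2k + 2j`, leftward
return to `d = p + 2j`) the walk agrees with the T table of parameter `a = (p−1)/2` at every time `≤ m`.
[cite: MadrasSlade1993, §4.2, Definition 4.2.1 (p. 90); EntingJensen2009, §7.4.2, Fig. 7.10] -/
theorem dduuS_table_t {k j m p q r s : ℕ} {e1 e2 e3 : ℤ} (hm : m = 6 * k + 2 * j)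
    (hR0 : ∀ i, i ≤ p → ω i 0 = i ∧ ω i 1 = 0)
    (hrun1 : ∀ i, p + 1 ≤ i → i ≤ q → ω i 0 = p + e1 * ((i - (p + 1) : ℕ) : ℤ) ∧ ω i 1 = -1)
    (hrun2 : ∀ i, q + 1 ≤ i → i ≤ r → ω i 0 = ω q 0 + e2 * ((i - (q + 1) : ℕ) : ℤ) ∧ ω i 1 = -2)
    (hrun3 : ∀ i, r + 1 ≤ i → i ≤ s → ω i 0 = ω r 0 + e3 * ((i - (r + 1) : ℕ) : ℤ) ∧ ω i 1 = -1)
    (hR4 : ∀ j, s + 1 ≤ j → j ≤ m → ω j 0 = ω s 0 + ((j - (s + 1) : ℕ) : ℤ) ∧ ω j 1 = 0)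
    (hpq : p < q) (hqr : q < r) (hrs : r < s) (hsm : s < m) (hpodd : p % 2 = 1) (hs_eq : s = p + 4 * k + 2 * j - 1)
    (hbq : ω q 0 = p + e1 * ((q - (p + 1) : ℕ) : ℤ)) (hcr : ω r 0 = ω q 0 + e2 * ((r - (q + 1) : ℕ) : ℤ))
    (hds : ω s 0 = ω r 0 + e3 * ((s - (r + 1) : ℕ) : ℤ))
    (he1 : e1 = -1) (hb : ω q 0 = 2) (he2 : e2 = 1) (he3 : e3 = -1) (hc : ω r 0 = 2 * k + 2 * j) (hd : ω s 0 = p + 2 * j) :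
    ∃ a, 1 ≤ a ∧ a + 1 ≤ k ∧ ∀ i, i ≤ m → ω i 0 = s2tX k j a i ∧ ω i 1 = s2tY k j a i := by
  subst he1 he2 he3
  have hq_eq : q = 2 * p - 1 := by omega
  have hr_eq : r = 2 * p + 2 * k + 2 * j - 2 := by omega
  clear hcr hds hbq
  refine ⟨p / 2, by omega, by omega, fun i hi => ?_⟩
  simp only [s2tX, s2tY]
  rcases Nat.lt_or_ge i (p + 1) with h1 | h1
  · obtain ⟨hx, hy⟩ := hR0 i (by omega)
    rw [hx, hy]; constructor <;> split_ifs <;> omega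
  rcases Nat.lt_or_ge i (q + 1) with h2 | h2
  · obtain ⟨hx, hy⟩ := hrun1 i h1 (by omega)
    rw [hx, hy]; constructor <;> split_ifs <;> omega
  rcases Nat.lt_or_ge i (r + 1) with h3 | h3
  · obtain ⟨hx, hy⟩ := hrun2 i h2 (by omega)
    rw [hx, hy]; constructor <;> split_ifs <;> omega
  rcases Nat.lt_or_ge i (s + 1) with h4 | h4
  · obtain ⟨hx, hy⟩ := hrun3 i h3 (by omega)
    rw [hx, hy]; constructor <;> split_ifs <;> omega
  · obtain ⟨hx, hy⟩ := hR4 i h4 hi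
    rw [hx, hy]; constructor <;> split_ifs <;> omega

/-- DDUU at slack `2j`, step 3c — **the H tables**: with the H signs and columns (`p = 2k − 1`, hairpin to `b = 2`, `c` even in
`[2k, 2k + 2j]`, rightward to `d = 2k + 2j + 1`) the walk agrees with the H table of parameter `i = (c − 2k)/2` at every time `≤ m`.
[cite: MadrasSlade1993, §4.2, Definition 4.2.1 (p. 90); EntingJensen2009, §7.4.2, Fig. 7.10] -/
theorem dduuS_table_h {k j m p q r s : ℕ} {e1 e2 e3 : ℤ} (hk : 2 ≤ k) (hm : m = 6 * k + 2 * j)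
    (hR0 : ∀ i, i ≤ p → ω i 0 = i ∧ ω i 1 = 0)
    (hrun1 : ∀ i, p + 1 ≤ i → i ≤ q → ω i 0 = p + e1 * ((i - (p + 1) : ℕ) : ℤ) ∧ ω i 1 = -1)
    (hrun2 : ∀ i, q + 1 ≤ i → i ≤ r → ω i 0 = ω q 0 + e2 * ((i - (q + 1) : ℕ) : ℤ) ∧ ω i 1 = -2)
    (hrun3 : ∀ i, r + 1 ≤ i → i ≤ s → ω i 0 = ω r 0 + e3 * ((i - (r + 1) : ℕ) : ℤ) ∧ ω i 1 = -1)
    (hR4 : ∀ j, s + 1 ≤ j → j ≤ m → ω j 0 = ω s 0 + ((j - (s + 1) : ℕ) : ℤ) ∧ ω j 1 = 0)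
    (hpq : p < q) (hqr : q < r) (hrs : r < s) (hsm : s < m) (hpodd : p % 2 = 1) (hs_eq : s = p + 4 * k + 2 * j - 1)
    (hbq : ω q 0 = p + e1 * ((q - (p + 1) : ℕ) : ℤ)) (hcr : ω r 0 = ω q 0 + e2 * ((r - (q + 1) : ℕ) : ℤ))
    (hds : ω s 0 = ω r 0 + e3 * ((s - (r + 1) : ℕ) : ℤ))
    (he1 : e1 = -1) (hb : ω q 0 = 2) (he2 : e2 = 1) (he3 : e3 = 1) (hp : p = 2 * k - 1) (hd : ω s 0 = 2 * k + 2 * j + 1)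
    (hc : 2 * (k : ℤ) ≤ ω r 0 ∧ ω r 0 ≤ 2 * k + 2 * j) (hcev : ω r 0 % 2 = 0) :
    ∃ i, i ≤ j ∧ ∀ t, t ≤ m → ω t 0 = s2hX k j i t ∧ ω t 1 = s2hY k j i t := by
  subst he1 he2 he3 hp
  obtain ⟨l, hl, hcl⟩ : ∃ l : ℕ, l ≤ j ∧ ω r 0 = 2 * k + 2 * l :=
    ⟨((ω r 0).toNat - 2 * k) / 2, by omega, by omega⟩
  have hq_eq : q = 4 * k - 3 := by omega
  have hr_eq : r = 6 * k - 4 + 2 * l := by omega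
  clear hcr hds hbq hc
  refine ⟨l, hl, fun i hi => ?_⟩
  simp only [s2hX, s2hY]
  rcases Nat.lt_or_ge i (2 * k - 1 + 1) with h1 | h1
  · obtain ⟨hx, hy⟩ := hR0 i (by omega)
    rw [hx, hy]; constructor <;> split_ifs <;> omega
  rcases Nat.lt_or_ge i (q + 1) with h2 | h2
  · obtain ⟨hx, hy⟩ := hrun1 i h1 (by omega)
    rw [hx, hy]; constructor <;> split_ifs <;> omega
  rcases Nat.lt_or_ge i (r + 1) with h3 | h3
  · obtain ⟨hx, hy⟩ := hrun2 i h2 (by omega)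
    rw [hx, hy]; constructor <;> split_ifs <;> omega
  rcases Nat.lt_or_ge i (s + 1) with h4 | h4
  · obtain ⟨hx, hy⟩ := hrun3 i h3 (by omega)
    rw [hx, hy]; constructor <;> split_ifs <;> omega
  · obtain ⟨hx, hy⟩ := hR4 i h4 hi
    rw [hx, hy]; constructor <;> split_ifs <;> omega

/-- DDUU at slack `2j`, step 3 — **the tables**: with the signs and columns fixed, the walk agrees with an O table (`i = (b − 2)/2`),
a T table (`a = (p−1)/2`) or an H table (`i = (c − 2k)/2`) at every time `≤ m`.
[cite: MadrasSlade1993, §4.2, Definition 4.2.1 (p. 90); EntingJensen2009, §7.4.2, Fig. 7.10] -/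
theorem dduuS_tables {k j m p q r s : ℕ} {e1 e2 e3 : ℤ} (hk : 2 ≤ k) (hm : m = 6 * k + 2 * j)
    (hR0 : ∀ i, i ≤ p → ω i 0 = i ∧ ω i 1 = 0)
    (hrun1 : ∀ i, p + 1 ≤ i → i ≤ q → ω i 0 = p + e1 * ((i - (p + 1) : ℕ) : ℤ) ∧ ω i 1 = -1)
    (hrun2 : ∀ i, q + 1 ≤ i → i ≤ r → ω i 0 = ω q 0 + e2 * ((i - (q + 1) : ℕ) : ℤ) ∧ ω i 1 = -2)
    (hrun3 : ∀ i, r + 1 ≤ i → i ≤ s → ω i 0 = ω r 0 + e3 * ((i - (r + 1) : ℕ) : ℤ) ∧ ω i 1 = -1)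
    (hR4 : ∀ j, s + 1 ≤ j → j ≤ m → ω j 0 = ω s 0 + ((j - (s + 1) : ℕ) : ℤ) ∧ ω j 1 = 0)
    (hpq : p < q) (hqr : q < r) (hrs : r < s) (hsm : s < m) (hpodd : p % 2 = 1) (hs_eq : s = p + 4 * k + 2 * j - 1)
    (hbq : ω q 0 = p + e1 * ((q - (p + 1) : ℕ) : ℤ)) (hcr : ω r 0 = ω q 0 + e2 * ((r - (q + 1) : ℕ) : ℤ))
    (hds : ω s 0 = ω r 0 + e3 * ((s - (r + 1) : ℕ) : ℤ)) (hbev : ω q 0 % 2 = 0) (hcev : ω r 0 % 2 = 0)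
    (hsig : (p = 1 ∧ e1 = 1 ∧ (2 ≤ ω q 0 ∧ ω q 0 + 2 ≤ 2 * j) ∧ e2 = 1 ∧ ω r 0 = 2 * k + 2 * j - 2 ∧ e3 = -1 ∧
        ω s 0 = 2 * j - 1) ∨
      (e1 = -1 ∧ ω q 0 = 2 ∧ e2 = 1 ∧ e3 = -1 ∧ ω r 0 = 2 * k + 2 * j ∧ ω s 0 = p + 2 * j ∧ p + 2 ≤ 2 * k + 1) ∨
      (e1 = -1 ∧ ω q 0 = 2 ∧ e2 = 1 ∧ e3 = 1 ∧ p = 2 * k - 1 ∧ ω s 0 = 2 * k + 2 * j + 1 ∧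
        (2 * (k : ℤ) ≤ ω r 0 ∧ ω r 0 ≤ 2 * k + 2 * j))) :
    (∃ i, i + 2 ≤ j ∧ ∀ t, t ≤ m → ω t 0 = s2oX k j i t ∧ ω t 1 = s2oY k j i t) ∨
      (∃ a, 1 ≤ a ∧ a + 1 ≤ k ∧ ∀ i, i ≤ m → ω i 0 = s2tX k j a i ∧ ω i 1 = s2tY k j a i) ∨
      ∃ i, i ≤ j ∧ ∀ t, t ≤ m → ω t 0 = s2hX k j i t ∧ ω t 1 = s2hY k j i t := by
  rcases hsig with ⟨hp, he1, hb, he2, hc, he3, hd⟩ | ⟨he1, hb, he2, he3, hc, hd, -⟩ | ⟨he1, hb, he2, he3, hp, hd, hc⟩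
  · exact Or.inl (dduuS_table_o hm hR0 hrun1 hrun2 hrun3 hR4 hpq hqr hrs hpodd hs_eq hbq hcr hds hp he1 hb hbev he2 hc he3 hd)
  · exact Or.inr (Or.inl
      (dduuS_table_t hm hR0 hrun1 hrun2 hrun3 hR4 hpq hqr hrs hsm hpodd hs_eq hbq hcr hds he1 hb he2 he3 hc hd))
  · exact Or.inr (Or.inr
      (dduuS_table_h hk hm hR0 hrun1 hrun2 hrun3 hR4 hpq hqr hrs hsm hpodd hs_eq hbq hcr hds he1 hb he2 he3 hp hd hc hcev))

/-- **Profile `D D U U` at slack `2j` is an O, T or H block** (as coordinate tables): `dduuS_runs` + `dduu_row_disjoint` +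
`dduu_shield_low/high` (general length, `HexSAWSurfaceWallRenewalSlackTwoClassification`) + `dduuS_signs` + `dduuS_tables`.
[cite: MadrasSlade1993, §4.2, Definition 4.2.1 (p. 90); EntingJensen2009, §7.4.2, Fig. 7.10] -/
theorem dduu_any_slack {k j m : ℕ} (hk : 2 ≤ k) (hj : 1 ≤ j) (hm : m = 6 * k + 2 * j) (hω : ω ∈ ipwb m)
    (hv : visits m ω = k)
    {p q r s : ℕ} (hDpq : stepsD m ω = {p, q}) (hUrs : stepsU m ω = {r, s}) (hpq : p < q) (hrs : r < s)
    (hqr : q < r) (hp1 : 1 ≤ p) (hpodd : p % 2 = 1) (hR0 : ∀ i, i ≤ p → ω i 0 = i ∧ ω i 1 = 0)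
    (hP1x : ω (p + 1) 0 = p) (hP1y : ω (p + 1) 1 = -1)
    (hhor : ∀ i, i < m → i ≠ p → i ≠ q → i ≠ r → i ≠ s →
      ω (i + 1) 1 = ω i 1 ∧ (ω (i + 1) 0 = ω i 0 + 1 ∨ ω (i + 1) 0 = ω i 0 - 1)) :
    (∃ i, i + 2 ≤ j ∧ ∀ t, t ≤ m → ω t 0 = s2oX k j i t ∧ ω t 1 = s2oY k j i t) ∨
      (∃ a, 1 ≤ a ∧ a + 1 ≤ k ∧ ∀ i, i ≤ m → ω i 0 = s2tX k j a i ∧ ω i 1 = s2tY k j a i) ∨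
      ∃ i, i ≤ j ∧ ∀ t, t ≤ m → ω t 0 = s2hX k j i t ∧ ω t 1 = s2hY k j i t := by
  classical
  obtain ⟨hpw, hn1, hirr⟩ := mem_ipwb.1 hω
  obtain ⟨hw, hb⟩ := mem_pwb.1 hpw
  obtain ⟨ha, -⟩ := mem_wbr.1 hw
  obtain ⟨hh, hm2, -⟩ := mem_archs.1 ha
  obtain ⟨hs, -⟩ := mem_hpw.1 hh
  obtain ⟨-, -, -, hinj⟩ := mem_saws_iff.1 hs
  obtain ⟨e1, e2, e3, he1, he2, he3, hrun1, hrun2, hrun3, hR4, hs_eq, hd3, hbev, hcev, hb1, hc1, hq2, hr2, hsm, hcX⟩ :=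
    dduuS_runs hk hj hm hω hv hDpq hUrs hpq hrs hqr hp1 hR0 hP1x hP1y hhor
  have hbq := (hrun1 q (by omega) le_rfl).1
  have hcr := (hrun2 r (by omega) le_rfl).1
  have hds := (hrun3 s (by omega) le_rfl).1
  have hN := (hR4 m (by omega) le_rfl).1
  have hrx : ω (r + 1) 0 = ω r 0 := by rw [(hrun3 (r + 1) le_rfl (by omega)).1]; simp
  have hd : (p : ℤ) + 2 ≤ ω s 0 := hd3.1
  have hdisj := dduu_row_disjoint hinj hqr hsm hrun1 hrun3
  have hI1 : 3 ≤ p → ω q 0 ≤ 2 ∨ ω r 0 ≤ 2 := fun hp3 =>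
    dduu_shield_low hb hirr hR0 he1 he2 he3 hrun1 hrun2 hrun3 hR4 hp3 hpq hqr hrs hsm hd hbq hcr hds
  have hI2 : s + 4 ≤ m → ω m 0 ≤ ω q 0 + 1 ∨ ω m 0 ≤ ω r 0 + 1 := fun hs4 =>
    dduu_shield_high hb hirr hR0 he1 he2 he3 hrun1 hrun2 hrun3 hR4 hs4 hm2 hpq hqr hrs hd hbq hcr hds
  have hsig := dduuS_signs hk hj hm he1 he2 he3 hp1 hpodd hrs hs_eq hd3 hbev hcev hb1 hc1 hq2 hr2 hsm hcX hbq hcr hds hN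
    hP1x hrx (fun i h1 h2 => (hrun1 i h1 h2).1) (fun i h1 h2 => (hrun3 i h1 h2).1) hdisj hI1 hI2
  exact dduuS_tables hk hm hR0 hrun1 hrun2 hrun3 hR4 hpq hqr hrs hsm hpodd hs_eq hbq hcr hds hbev hcev hsig

/-! ### §6  Assembly: the two-down stratum at slack `2j` is the two-down Finset, `2j + k − 1` blocks -/

open Classical in
/-- ★★★ **Two down steps at any slack**: an irreducible positive wall bridge of length `6k + 2j` (`k ≥ 2`, `j ≥ 1`) with `k`
visits and exactly two down steps is an O block, a T block or an H block. [cite: MadrasSlade1993, §4.2, Definition 4.2.1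
(p. 90) and the remark before (4.2.21) (p. 94)] [cite: EntingJensen2009, §7.4.2, Fig. 7.10] -/
theorem mem_twoDownBlocksS_of_card_stepsD_eq_two {k j m : ℕ} (hk : 2 ≤ k) (hj : 1 ≤ j) (hm : m = 6 * k + 2 * j)
    (hω : ω ∈ ipwb m) (hv : visits m ω = k) (hD : #(stepsD m ω) = 2) : ω ∈ twoDownBlocksS k j := by
  have hs : ω ∈ saws m := saws_of_mem_pwb (mem_ipwb.1 hω).1
  have hm' : 6 * k + 2 * j = m := hm.symm
  have hU : #(stepsU m ω) = 2 := by rw [card_stepsU_eq_card_stepsD hω (by omega), hD]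
  obtain ⟨p, q, r, s, hDpq, hUrs, hpq, hrs, hpr, hqs, hp1, hpodd, hR0, hP1x, hP1y, hhor, -⟩ :=
    profile_of_card_stepsD_eq_two hω hD hU
  have hqr' : q ≠ r := by
    intro h
    obtain ⟨-, -, hbw, -⟩ := mem_saws_iff.1 hs
    obtain ⟨-, -, hqy, -⟩ := of_mem_stepsD_coord hbw (i := q) (by rw [hDpq]; simp)
    obtain ⟨-, -, hry, -⟩ := of_mem_stepsU_coord hbw (i := r) (by rw [hUrs]; simp)
    rw [h] at hqy; omega
  rcases lt_or_gt_of_ne hqr' with hqr | hrq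
  · simp only [twoDownBlocksS, s2oBlocks, s2tBlocks, s2hBlocks, mem_union, mem_image, mem_range]
    rcases dduu_any_slack hk hj hm hω hv hDpq hUrs hpq hrs hqr hp1 hpodd hR0 hP1x hP1y hhor with
      ⟨i, hi, htab⟩ | ⟨a, ha, hak, htab⟩ | ⟨i, hi, htab⟩
    · refine Or.inl (Or.inl ⟨i, by omega, ?_⟩)
      rw [s2o, hm']
      exact (eq_tab_walk_of_forall hs (by rw [← hm'] at htab ⊢; exact htab)).symm
    · refine Or.inl (Or.inr ⟨a - 1, by omega, ?_⟩)
      rw [show a - 1 + 1 = a by omega, s2t, hm']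
      exact (eq_tab_walk_of_forall hs (by rw [← hm'] at htab ⊢; exact htab)).symm
    · refine Or.inr ⟨i, by omega, ?_⟩
      rw [s2h, hm']
      exact (eq_tab_walk_of_forall hs (by rw [← hm'] at htab ⊢; exact htab)).symm
  · exact (dudu_false_of_mem_ipwb hω hDpq hUrs hpq hrs hpr hqs hrq hR0 hP1x hP1y hhor).elim

open Classical in
/-- ★★★ **The two-down stratum as a set, at every slack**: for `k ≥ 2`, `j ≥ 1` and `m = 6k + 2j`, the irreducible positive
wall bridges of length `m` with `k` visits and two down steps are exactly the two-down Finset `twoDownBlocksS k j`. OURS.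
[cite: MadrasSlade1993, §4.2, Definition 4.2.1 (p. 90), remark before (4.2.21) (p. 94)] [cite: EntingJensen2009, §7.4.2,
Fig. 7.10] -/
theorem filter_visits_two_down_eq_twoDownBlocksS {k j m : ℕ} (hk : 2 ≤ k) (hj : 1 ≤ j) (hm : m = 6 * k + 2 * j) :
    (ipwb m).filter (fun ω => visits m ω = k ∧ #(stepsD m ω) = 2) = twoDownBlocksS k j := by
  refine Subset.antisymm (fun ζ hζ => ?_) (twoDownBlocksS_subset hk hj hm)
  rw [mem_filter] at hζ
  exact mem_twoDownBlocksS_of_card_stepsD_eq_two hk hj hm hζ.1 hζ.2.1 hζ.2.2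

open Classical in
/-- ★★★ **The two-down law `#{ω ∈ ipwb (6k + 2j) : visits = k, #down = 2} = 2j + k − 1`** (`k ≥ 2`, `j ≥ 1`): linear in
the slack and in the number of visits — `k + 1` at slack two (`card_filter_visits_slack_two`-compatible), `k + 3` at slack
four, `k + 5` at slack six, …; in the table `N_{3k+j,k}` of the census this is the whole two-down stratum. OURS.
[cite: MadrasSlade1993, §4.2, Definition 4.2.1 (p. 90), remark before (4.2.21) (p. 94)] [cite: EntingJensen2009, §7.4.2,
Fig. 7.10] -/
theorem card_filter_visits_two_down_slack {k j m : ℕ} (hk : 2 ≤ k) (hj : 1 ≤ j) (hm : m = 6 * k + 2 * j) :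
    #((ipwb m).filter fun ω => visits m ω = k ∧ #(stepsD m ω) = 2) = 2 * j + k - 1 := by
  classical
  rw [filter_visits_two_down_eq_twoDownBlocksS hk hj hm, card_twoDownBlocksS hk hj]

end Literature.Probability.RandomPlanarGeometry.SAW.HexBW.Wall
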